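import Literature.Geometry.Lorentzian.KIDChartProlongation
import Literature.Geometry.Lorentzian.CoordKIDEquations
import HarnessLib

/-!
# The KID equations are of finite type: all second derivatives are controlled by the 1-jet

The KID-specific half of the one-jet rigidity of Killing initial data, on top of the generic
prolongation bound with a source of `KIDChartProlongation.lean` (Moncrief 1975, §III: the KIDs of
vacuum data are the Cauchy data of the Killing fields of the vacuum development, hence determined
by finitely many derivatives at a point; Beig–Chruściel 1997, §2: the KID system prolongs to a
closed first-order system; Chruściel–Delay 2003, §2, the operator `P*`). For vacuum data `(G, K)` on an open
set `V` of a finite-dimensional space (`MetricCoord.IsMetricOn G V`, any signature, `dim ≠ 1`;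
`K` smooth symmetric; constraints `H = 0`, `M = 0` on `V`) and a `C²` solution `(N, X)` of the KID
equations `DH*_γ N + DM*ˢ_γ X = 0`, `DH*_κ N + DM*ˢ_κ X = 0` (`CoordConstraintAdjoint.lean`):

* `lie_apply_eq_of_kid` — the `κ`-row is the inhomogeneous Killing equation `𝓛_X G = -4N K`
  (`MetricCoord.IsMetricOn.lieFormAt_metric_eq_of_kidK`), in the applied form consumed by
  `KIDChartProlongation.lean`; `contDiffOn_source`, `norm_fderiv_source_le` — the source `-4N K`
  is `C¹` with `‖D(-4N K)_y‖ ≤ 4 (|N y| ‖DK_y‖ + ‖dN_y‖ ‖K_y‖)`;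
* `exists_norm_fderiv_fderiv_lapse_le` — **the lapse**: `‖D²N_x‖ ≤ C (|N x| + ‖dN_x‖ + ‖X x‖ +
  ‖DX_x‖)` near every point, from the second KID equation
  `Hess N = N Ric + N (tr K) K - 2N K∘♯K - ½ 𝓛_X K` (`MetricCoord.IsMetricOn.kid₂_eq_zero`,
  Moncrief 1975, §IV; Beig–Chruściel 1997, (1.4)) and `D²N = Hess N + dN ∘ Γ`;
* `exists_norm_jet_deriv_le` — **the full 1-jet**: `‖D²N_x‖ + ‖D²X_x‖ ≤ C (|N x| + ‖dN_x‖ +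
  ‖X x‖ + ‖DX_x‖)` near every point of `V` (shift through the braid identity with source
  `-4N K`, `KIDJetRigidity.exists_norm_fderiv_fderiv_le` of `KIDChartProlongation.lean`; lapse as
  above); `eventually_norm_le_of_continuousAt`, `nondegenerate_of_isMetricOn` — bookkeeping.

Everything is proved; no definitions, no named facts.

## References

* V. Moncrief, J. Math. Phys. 16 (1975) 493–498, §§III–IV. [Moncrief1975]
* R. Beig, P. T. Chruściel, Class. Quantum Grav. 14 (1997) A83–A92, (1.3)–(1.4), §2.
* B. O'Neill, *Semi-Riemannian geometry*, Academic Press 1983, Ch. 3; Ch. 9, Lemma 9.28. [ONeill1983]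
-/

noncomputable section

-- instance search through the nested operator types `E →L[ℝ] E →L[ℝ] E →L[ℝ] ℝ` (as in the tree files)
set_option maxSynthPendingDepth 3

open Set Filter Module Function Metric

open scoped ContDiff Topology

namespace Literature.Geometry.Lorentzian

namespace KIDJetRigidity

variable {E : Type*} [NormedAddCommGroup E] [NormedSpace ℝ E] [FiniteDimensional ℝ E]
  {G : E → E →L[ℝ] E →L[ℝ] ℝ} {X : E → E}

/-! ### The KID equations as a prolongable system: the source `B = -4N K` and the lapse bound -/

section KID

variable [CompleteSpace E] {ι : Type*} [Fintype ι] (b : Basis ι ℝ E)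
  {K : E → E →L[ℝ] E →L[ℝ] ℝ} {V : Set E} {N : E → ℝ}

omit [FiniteDimensional ℝ E] [CompleteSpace E] in
/-- `|T(z, u, w)| ≤ ‖T‖ ‖z‖ ‖u‖ ‖w‖` for a trilinear form given as iterated operators (local copy of
`MetricCoord.norm_apply₃_le` of `CoordLaplacianPerturbation.lean`, kept private to keep this file's
import cone small). [folklore] -/
private theorem norm_apply₃_le (T : E →L[ℝ] E →L[ℝ] E →L[ℝ] ℝ) (z u w : E) :
    ‖T z u w‖ ≤ ‖T‖ * ‖z‖ * ‖u‖ * ‖w‖ :=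
  calc ‖T z u w‖ ≤ ‖T z u‖ * ‖w‖ := (T z u).le_opNorm w
    _ ≤ ‖T z‖ * ‖u‖ * ‖w‖ := by gcongr; exact (T z).le_opNorm u
    _ ≤ ‖T‖ * ‖z‖ * ‖u‖ * ‖w‖ := by gcongr; exact T.le_opNorm z

omit [NormedSpace ℝ E] [FiniteDimensional ℝ E] [CompleteSpace E] in
/-- A function continuous at `x₀` is bounded in norm by `‖f x₀‖ + 1` near `x₀`. [folklore] -/
theorem eventually_norm_le_of_continuousAt {F : Type*} [SeminormedAddCommGroup F] {f : E → F}
    {x₀ : E} (hf : ContinuousAt f x₀) : ∀ᶠ x in 𝓝 x₀, ‖f x‖ ≤ ‖f x₀‖ + 1 := by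
  have h := Metric.continuousAt_iff'.1 hf 1 one_pos
  filter_upwards [h] with x hx
  rw [dist_eq_norm] at hx
  have := norm_le_insert' (f x) (f x₀)
  linarith

omit [CompleteSpace E] in
/-- **The first KID equation as an inhomogeneous Killing equation**: the `κ`-row of `DΦ*(N, X) = 0`
gives `𝓛_X G = -4N K`, i.e. `DG_y(X y)(u,w) + G_y(DX_y u, w) + G_y(u, DX_y w) = -4 N(y) K_y(u, w)`
(Moncrief 1975, §IV; lapse `2N` in the normalisation of the tree). [cite: Moncrief1975, §IV] -/
theorem lie_apply_eq_of_kid (hG : MetricCoord.IsMetricOn G V) (hn : finrank ℝ E ≠ 1)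
    (hκ : ∀ y ∈ V, MetricCoord.adjHamK G K N y + MetricCoord.adjMomKS G X y = 0) :
    ∀ y ∈ V, ∀ u w, fderiv ℝ G y (X y) u w + G y (fderiv ℝ X y u) w + G y u (fderiv ℝ X y w) =
      (fun y ↦ -(4 * N y) • K y) y u w := by
  intro y hy u w
  have h := hG.lieFormAt_metric_eq_of_kidK hy hn (hκ y hy)
  have huw := congrArg (fun B : E →L[ℝ] E →L[ℝ] ℝ ↦ B u w) h
  simpa [MetricCoord.lieFormAt_apply] using huw

omit [FiniteDimensional ℝ E] [CompleteSpace E] in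
/-- The source `y ↦ -4 N(y) K_y` is `C¹` when `N` is `C²` and `K` is `C^∞`. [folklore] -/
theorem contDiffOn_source (hV : IsOpen V) (hK : ContDiffOn ℝ ∞ K V) (hN : ContDiffOn ℝ 2 N V) :
    ContDiffOn ℝ 1 (fun y ↦ -(4 * N y) • K y) V := by
  have _ := hV
  have hN1 : ContDiffOn ℝ 1 N V := hN.of_le (by norm_num)
  have hK1 : ContDiffOn ℝ 1 K V := hK.of_le (by simp)
  exact ((contDiffOn_const.mul hN1).neg).smul hK1

omit [FiniteDimensional ℝ E] [CompleteSpace E] in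
/-- **Derivative of the source**: `D(-4N K)_y = -4N(y) DK_y - 4 dN_y ⊗ K_y`, so
`‖D(-4N K)_y‖ ≤ 4 (|N y| ‖DK_y‖ + ‖dN_y‖ ‖K_y‖)`. [folklore] -/
theorem norm_fderiv_source_le {y : E} (hKd : DifferentiableAt ℝ K y) (hNd : DifferentiableAt ℝ N y) :
    ‖fderiv ℝ (fun y ↦ -(4 * N y) • K y) y‖ ≤
      4 * (|N y| * ‖fderiv ℝ K y‖ + ‖fderiv ℝ N y‖ * ‖K y‖) := by
  have hc : HasFDerivAt (fun y ↦ -(4 * N y)) (-((4 : ℝ) • fderiv ℝ N y)) y :=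
    (hNd.hasFDerivAt.const_mul 4).neg
  have h : HasFDerivAt (fun y ↦ -(4 * N y) • K y)
      (-(4 * N y) • fderiv ℝ K y + (-((4 : ℝ) • fderiv ℝ N y)).smulRight (K y)) y :=
    hc.smul hKd.hasFDerivAt
  rw [h.fderiv]
  calc ‖-(4 * N y) • fderiv ℝ K y + (-((4 : ℝ) • fderiv ℝ N y)).smulRight (K y)‖
      ≤ ‖-(4 * N y) • fderiv ℝ K y‖ + ‖(-((4 : ℝ) • fderiv ℝ N y)).smulRight (K y)‖ :=
        norm_add_le _ _
    _ = 4 * (|N y| * ‖fderiv ℝ K y‖ + ‖fderiv ℝ N y‖ * ‖K y‖) := by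
        rw [norm_smul, ContinuousLinearMap.norm_smulRight_apply, norm_neg, norm_neg, norm_smul,
          norm_mul]
        simp only [Real.norm_eq_abs, abs_of_pos (by norm_num : (0 : ℝ) < 4)]
        ring

-- many operator-norm estimates through iterated operator spaces: the default budget is too small
set_option maxHeartbeats 800000 in
/-- **Prolongation bound for the lapse.** For vacuum data `(G, K)` on `V` (`G` a metric, `K`
smooth symmetric, `H = 0`, `M = 0`), a KID `(N, X)` of class `C²` satisfies near every point of `V`
`‖D²N_x‖ ≤ C (|N x| + ‖dN_x‖ + ‖X x‖ + ‖DX_x‖)`: by the second KID equation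
`Hess N = N Ric + N (tr K) K - 2N K∘♯K - ½ 𝓛_X K` (`MetricCoord.IsMetricOn.kid₂_eq_zero`) and
`D²N = Hess N + dN ∘ Γ`, with locally bounded coefficients `Ric`, `Γ`, `♯`, `K`, `DK`, `tr K`.
Moncrief 1975, §IV; Beig–Chruściel 1997, (1.4). [cite: Moncrief1975, §IV] -/
theorem exists_norm_fderiv_fderiv_lapse_le (hG : MetricCoord.IsMetricOn G V) (hn : finrank ℝ E ≠ 1)
    (hK : ContDiffOn ℝ ∞ K V) (hKs : ∀ y ∈ V, ∀ v w, K y v w = K y w v)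
    (hX : ContDiffOn ℝ 2 X V)
    (hvac : ∀ y ∈ V, MetricCoord.hamAt G K y = 0 ∧ ∀ Z, MetricCoord.momFn b G K y Z = 0)
    (hkid : ∀ y ∈ V, MetricCoord.adjHamG G K N y + MetricCoord.adjMomGS G K X y = 0 ∧
      MetricCoord.adjHamK G K N y + MetricCoord.adjMomKS G X y = 0)
    {x₀ : E} (hx₀ : x₀ ∈ V) :
    ∃ C : ℝ, ∀ᶠ x in 𝓝 x₀, ‖fderiv ℝ (fderiv ℝ N) x‖ ≤
      C * (|N x| + ‖fderiv ℝ N x‖ + ‖X x‖ + ‖fderiv ℝ X x‖) := by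
  have hV : IsOpen V := hG.isOpen
  have hxs : V ∈ 𝓝 x₀ := hV.mem_nhds hx₀
  -- continuity of the coefficient fields at `x₀`
  have hRc : ContinuousAt (MetricCoord.ricAt G) x₀ := (hG.contDiffAt_ricAt hx₀).continuousAt
  have hΓc : ContinuousAt (MetricCoord.chrAt G) x₀ := (hG.contDiffAt_chrAt hx₀).continuousAt
  have hSc : ContinuousAt (MetricCoord.sharpAt G) x₀ := (hG.contDiffAt_sharpAt hx₀).continuousAt
  have hKc : ContinuousAt K x₀ := (hK.continuousOn.continuousWithinAt hx₀).continuousAt hxs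
  have hK1 : ContDiffOn ℝ ∞ (fderiv ℝ K) V := hK.fderiv_of_isOpen hV (by simp)
  have hDKc : ContinuousAt (fderiv ℝ K) x₀ :=
    (hK1.continuousOn.continuousWithinAt hx₀).continuousAt hxs
  have hTc : ContinuousAt (fun y ↦ MetricCoord.mtrAt G y (K y)) x₀ :=
    ((hG.contDiffOn_mtrAt hK).continuousOn.continuousWithinAt hx₀).continuousAt hxs
  set R : ℝ := ‖MetricCoord.ricAt G x₀‖ + 1 with hR
  set Γb : ℝ := ‖MetricCoord.chrAt G x₀‖ + 1 with hΓb
  set S : ℝ := ‖MetricCoord.sharpAt G x₀‖ + 1 with hS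
  set Kb : ℝ := ‖K x₀‖ + 1 with hKb
  set DKb : ℝ := ‖fderiv ℝ K x₀‖ + 1 with hDKb
  set Tb : ℝ := ‖MetricCoord.mtrAt G x₀ (K x₀)‖ + 1 with hTb
  have hR' := eventually_norm_le_of_continuousAt hRc
  have hΓ' := eventually_norm_le_of_continuousAt hΓc
  have hS' := eventually_norm_le_of_continuousAt hSc
  have hK' := eventually_norm_le_of_continuousAt hKc
  have hDK' := eventually_norm_le_of_continuousAt hDKc
  have hT' := eventually_norm_le_of_continuousAt hTc
  refine ⟨R + Tb * Kb + 2 * (Kb * S * Kb) + Γb + DKb + Kb, ?_⟩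
  filter_upwards [hR', hΓ', hS', hK', hDK', hT', hxs] with x hRx hΓx hSx hKx hDKx hTx hx
  have hR0 : 0 ≤ R := by positivity
  have hΓ0 : 0 ≤ Γb := by positivity
  have hS0 : 0 ≤ S := by positivity
  have hKb0 : 0 ≤ Kb := by positivity
  have hDKb0 : 0 ≤ DKb := by positivity
  have hTb0 : 0 ≤ Tb := by positivity
  have hxs' : V ∈ 𝓝 x := hV.mem_nhds hx
  have hKd : DifferentiableAt ℝ K x := (hK.differentiableOn (by simp)).differentiableAt hxs'
  have hXd : DifferentiableAt ℝ X x := (hX.differentiableOn two_ne_zero).differentiableAt hxs'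
  -- the second KID equation, solved for `Hess N`
  have h2 := hG.kid₂_eq_zero b hx hn hKd hKs hXd (hkid x hx).2 (hkid x hx).1 (hvac x hx).1
    ((hvac x hx).2 (X x))
  have hHess : MetricCoord.hessAt G N x = N x • MetricCoord.ricAt G x
      + (N x * MetricCoord.mtrAt G x (K x)) • K x
      - (2 * N x) • (K x).comp ((MetricCoord.sharpAt G x).comp (K x))
      - (2⁻¹ : ℝ) • MetricCoord.lieFormAt K X x := by
    rw [← sub_eq_zero]
    rw [← h2]
    abel
  set J : ℝ := |N x| + ‖fderiv ℝ N x‖ + ‖X x‖ + ‖fderiv ℝ X x‖ with hJ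
  have hJ0 : 0 ≤ J := by positivity
  have hNJ : |N x| ≤ J := by
    rw [hJ]; linarith [norm_nonneg (fderiv ℝ N x), norm_nonneg (X x), norm_nonneg (fderiv ℝ X x)]
  have hdNJ : ‖fderiv ℝ N x‖ ≤ J := by
    rw [hJ]; linarith [abs_nonneg (N x), norm_nonneg (X x), norm_nonneg (fderiv ℝ X x)]
  have hXJ : ‖X x‖ ≤ J := by
    rw [hJ]; linarith [abs_nonneg (N x), norm_nonneg (fderiv ℝ N x), norm_nonneg (fderiv ℝ X x)]
  have hDXJ : ‖fderiv ℝ X x‖ ≤ J := by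
    rw [hJ]; linarith [abs_nonneg (N x), norm_nonneg (fderiv ℝ N x), norm_nonneg (X x)]
  -- pointwise bound on `D²N(v, w)`
  have hpt : ∀ v w : E, ‖fderiv ℝ (fderiv ℝ N) x v w‖ ≤
      (R + Tb * Kb + 2 * (Kb * S * Kb) + Γb + DKb + Kb) * J * (‖v‖ * ‖w‖) := by
    intro v w
    have hvw : 0 ≤ ‖v‖ * ‖w‖ := by positivity
    have heq : fderiv ℝ (fderiv ℝ N) x v w =
        MetricCoord.hessAt G N x v w + fderiv ℝ N x (MetricCoord.chrAt G x v w) := by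
      rw [MetricCoord.hessAt_apply]; ring
    have hH : MetricCoord.hessAt G N x v w = N x * MetricCoord.ricAt G x v w
        + N x * MetricCoord.mtrAt G x (K x) * K x v w
        - 2 * N x * K x (MetricCoord.sharpAt G x (K x v)) w
        - 2⁻¹ * (fderiv ℝ K x (X x) v w + K x (fderiv ℝ X x v) w + K x v (fderiv ℝ X x w)) := by
      rw [hHess]
      simp only [sub_apply, add_apply, smul_apply, ContinuousLinearMap.comp_apply, smul_eq_mul,
        MetricCoord.lieFormAt_apply]
    -- the individual terms
    have e1 : |N x * MetricCoord.ricAt G x v w| ≤ R * J * (‖v‖ * ‖w‖) := by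
      rw [abs_mul]
      calc |N x| * |MetricCoord.ricAt G x v w| ≤ J * (‖MetricCoord.ricAt G x‖ * ‖v‖ * ‖w‖) := by
            gcongr; rw [← Real.norm_eq_abs]; exact (MetricCoord.ricAt G x).le_opNorm₂ v w
        _ ≤ J * (R * ‖v‖ * ‖w‖) := by gcongr
        _ = R * J * (‖v‖ * ‖w‖) := by ring
    have e2 : |N x * MetricCoord.mtrAt G x (K x) * K x v w| ≤ Tb * Kb * J * (‖v‖ * ‖w‖) := by
      rw [abs_mul, abs_mul]
      have hT1 : |MetricCoord.mtrAt G x (K x)| ≤ Tb := by rw [← Real.norm_eq_abs]; exact hTx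
      calc |N x| * |MetricCoord.mtrAt G x (K x)| * |K x v w|
          ≤ J * Tb * (‖K x‖ * ‖v‖ * ‖w‖) := by
            gcongr; rw [← Real.norm_eq_abs]; exact (K x).le_opNorm₂ v w
        _ ≤ J * Tb * (Kb * ‖v‖ * ‖w‖) := by gcongr
        _ = Tb * Kb * J * (‖v‖ * ‖w‖) := by ring
    have e3 : |2 * N x * K x (MetricCoord.sharpAt G x (K x v)) w| ≤
        2 * (Kb * S * Kb) * J * (‖v‖ * ‖w‖) := by
      rw [abs_mul, abs_mul, abs_two]
      have hin : ‖MetricCoord.sharpAt G x (K x v)‖ ≤ S * (Kb * ‖v‖) :=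
        calc ‖MetricCoord.sharpAt G x (K x v)‖ ≤ ‖MetricCoord.sharpAt G x‖ * ‖K x v‖ :=
              ContinuousLinearMap.le_opNorm _ _
          _ ≤ S * (‖K x‖ * ‖v‖) := by gcongr; exact ContinuousLinearMap.le_opNorm _ _
          _ ≤ S * (Kb * ‖v‖) := by gcongr
      calc 2 * |N x| * |K x (MetricCoord.sharpAt G x (K x v)) w|
          ≤ 2 * J * (‖K x‖ * ‖MetricCoord.sharpAt G x (K x v)‖ * ‖w‖) := by
            gcongr; rw [← Real.norm_eq_abs]; exact (K x).le_opNorm₂ _ w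
        _ ≤ 2 * J * (Kb * (S * (Kb * ‖v‖)) * ‖w‖) := by gcongr
        _ = 2 * (Kb * S * Kb) * J * (‖v‖ * ‖w‖) := by ring
    have e4 : |2⁻¹ * (fderiv ℝ K x (X x) v w + K x (fderiv ℝ X x v) w + K x v (fderiv ℝ X x w))|
        ≤ (DKb + Kb) * J * (‖v‖ * ‖w‖) := by
      rw [abs_mul, abs_of_pos (by norm_num : (0 : ℝ) < 2⁻¹)]
      have f1 : |fderiv ℝ K x (X x) v w| ≤ DKb * J * (‖v‖ * ‖w‖) := by
        rw [← Real.norm_eq_abs]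
        calc ‖fderiv ℝ K x (X x) v w‖ ≤ ‖fderiv ℝ K x‖ * ‖X x‖ * ‖v‖ * ‖w‖ :=
              norm_apply₃_le _ _ v w
          _ ≤ DKb * J * ‖v‖ * ‖w‖ := by gcongr
          _ = DKb * J * (‖v‖ * ‖w‖) := by ring
      have f2 : |K x (fderiv ℝ X x v) w| ≤ Kb * J * (‖v‖ * ‖w‖) := by
        rw [← Real.norm_eq_abs]
        calc ‖K x (fderiv ℝ X x v) w‖ ≤ ‖K x‖ * ‖fderiv ℝ X x v‖ * ‖w‖ := (K x).le_opNorm₂ _ w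
          _ ≤ ‖K x‖ * (‖fderiv ℝ X x‖ * ‖v‖) * ‖w‖ := by
              gcongr; exact ContinuousLinearMap.le_opNorm _ _
          _ ≤ Kb * (J * ‖v‖) * ‖w‖ := by gcongr
          _ = Kb * J * (‖v‖ * ‖w‖) := by ring
      have f3 : |K x v (fderiv ℝ X x w)| ≤ Kb * J * (‖v‖ * ‖w‖) := by
        rw [← Real.norm_eq_abs]
        calc ‖K x v (fderiv ℝ X x w)‖ ≤ ‖K x‖ * ‖v‖ * ‖fderiv ℝ X x w‖ := (K x).le_opNorm₂ v _
          _ ≤ ‖K x‖ * ‖v‖ * (‖fderiv ℝ X x‖ * ‖w‖) := by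
              gcongr; exact ContinuousLinearMap.le_opNorm _ _
          _ ≤ Kb * ‖v‖ * (J * ‖w‖) := by gcongr
          _ = Kb * J * (‖v‖ * ‖w‖) := by ring
      have hsum : |fderiv ℝ K x (X x) v w + K x (fderiv ℝ X x v) w + K x v (fderiv ℝ X x w)| ≤
          DKb * J * (‖v‖ * ‖w‖) + Kb * J * (‖v‖ * ‖w‖) + Kb * J * (‖v‖ * ‖w‖) :=
        (abs_add_le _ _).trans (add_le_add ((abs_add_le _ _).trans (add_le_add f1 f2)) f3)
      have hJvw : 0 ≤ DKb * J * (‖v‖ * ‖w‖) := by positivity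
      linarith only [hsum, hJvw]
    have e5 : |fderiv ℝ N x (MetricCoord.chrAt G x v w)| ≤ Γb * J * (‖v‖ * ‖w‖) := by
      rw [← Real.norm_eq_abs]
      calc ‖fderiv ℝ N x (MetricCoord.chrAt G x v w)‖
          ≤ ‖fderiv ℝ N x‖ * ‖MetricCoord.chrAt G x v w‖ := ContinuousLinearMap.le_opNorm _ _
        _ ≤ J * (‖MetricCoord.chrAt G x‖ * ‖v‖ * ‖w‖) := by
            gcongr; exact (MetricCoord.chrAt G x).le_opNorm₂ v w
        _ ≤ J * (Γb * ‖v‖ * ‖w‖) := by gcongr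
        _ = Γb * J * (‖v‖ * ‖w‖) := by ring
    rw [Real.norm_eq_abs, heq, hH]
    have htot := (abs_add_le _ _).trans (add_le_add ((abs_sub _ _).trans (add_le_add
      ((abs_sub _ _).trans (add_le_add ((abs_add_le _ _).trans (add_le_add e1 e2)) e3)) e4)) e5)
    refine htot.trans (le_of_eq ?_)
    ring
  refine ContinuousLinearMap.opNorm_le_bound _ (by positivity) fun v ↦ ?_
  refine ContinuousLinearMap.opNorm_le_bound _ (by positivity) fun w ↦ ?_
  calc ‖fderiv ℝ (fderiv ℝ N) x v w‖
      ≤ (R + Tb * Kb + 2 * (Kb * S * Kb) + Γb + DKb + Kb) * J * (‖v‖ * ‖w‖) := hpt v w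
    _ = (R + Tb * Kb + 2 * (Kb * S * Kb) + Γb + DKb + Kb) * J * ‖v‖ * ‖w‖ := by ring

end KID

/-! ### The full 1-jet bound, Grönwall along segments, and the open–closed argument -/

section Rigidity

variable [CompleteSpace E] {ι : Type*} [Fintype ι] (b : Basis ι ℝ E)
  {K : E → E →L[ℝ] E →L[ℝ] ℝ} {V : Set E} {N : E → ℝ}

omit [FiniteDimensional ℝ E] [CompleteSpace E] in
/-- A metric in the sense of `MetricCoord.IsMetricOn` is nondegenerate at every point of `V`.
[cite: ONeill1983, Ch. 3, Def. 3.1] -/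
theorem nondegenerate_of_isMetricOn (hG : MetricCoord.IsMetricOn G V) {y : E} (hy : y ∈ V) (u : E)
    (hu : ∀ w, G y u w = 0) : u = 0 := by
  have h0 : G y u = 0 := by
    ext w
    rw [hu w, zero_apply]
  exact (hG.isInvertible y hy).injective (h0.trans (map_zero (G y)).symm)

-- many operator-norm estimates through iterated operator spaces: the default budget is too small
set_option maxHeartbeats 400000 in
/-- **Prolongation bound for the full 1-jet of a KID.** For vacuum data `(G, K)` on `V` and a KID
`(N, X)` of class `C²`, near every point of `V`:
`‖D²N_x‖ + ‖D²X_x‖ ≤ C (|N x| + ‖dN_x‖ + ‖X x‖ + ‖DX_x‖)` — the shift through the braid identity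
for `𝓛_X G = -4N K` (`exists_norm_fderiv_fderiv_le`, `norm_fderiv_source_le`), the lapse through the
second KID equation (`exists_norm_fderiv_fderiv_lapse_le`). This is the statement that the KID
system is of finite type: all second derivatives are determined by the 1-jet (Moncrief 1975, §IV;
Beig–Chruściel 1997, §2). [cite: Moncrief1975, §IV] -/
theorem exists_norm_jet_deriv_le (hG : MetricCoord.IsMetricOn G V) (hn : finrank ℝ E ≠ 1)
    (hK : ContDiffOn ℝ ∞ K V) (hKs : ∀ y ∈ V, ∀ v w, K y v w = K y w v)
    (hN : ContDiffOn ℝ 2 N V) (hX : ContDiffOn ℝ 2 X V)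
    (hvac : ∀ y ∈ V, MetricCoord.hamAt G K y = 0 ∧ ∀ Z, MetricCoord.momFn b G K y Z = 0)
    (hkid : ∀ y ∈ V, MetricCoord.adjHamG G K N y + MetricCoord.adjMomGS G K X y = 0 ∧
      MetricCoord.adjHamK G K N y + MetricCoord.adjMomKS G X y = 0)
    {x₀ : E} (hx₀ : x₀ ∈ V) :
    ∃ C : ℝ, 0 ≤ C ∧ ∀ᶠ x in 𝓝 x₀, ‖fderiv ℝ (fderiv ℝ N) x‖ + ‖fderiv ℝ (fderiv ℝ X) x‖ ≤
      C * (|N x| + ‖fderiv ℝ N x‖ + ‖X x‖ + ‖fderiv ℝ X x‖) := by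
  have hV : IsOpen V := hG.isOpen
  have hxs : V ∈ 𝓝 x₀ := hV.mem_nhds hx₀
  -- the lapse
  obtain ⟨C₁, hC₁⟩ := exists_norm_fderiv_fderiv_lapse_le b hG hn hK hKs hX hvac hkid hx₀
  -- the shift: `𝓛_X G = -4N K`
  have hL := lie_apply_eq_of_kid hG hn fun y hy ↦ (hkid y hy).2
  have hB : ContDiffOn ℝ 1 (fun y ↦ -(4 * N y) • K y) V := contDiffOn_source hV hK hN
  obtain ⟨C₂, hC₂⟩ := exists_norm_fderiv_fderiv_le hV
    (hG.contDiffOn.of_le (WithTop.coe_le_coe.2 le_top)) hX (hB.differentiableOn one_ne_zero)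
    hG.symm hL hx₀ (fun u hu ↦ nondegenerate_of_isMetricOn hG hx₀ u hu)
  -- local bounds for `K`, `DK`
  have hKc : ContinuousAt K x₀ := (hK.continuousOn.continuousWithinAt hx₀).continuousAt hxs
  have hK1 : ContDiffOn ℝ ∞ (fderiv ℝ K) V := hK.fderiv_of_isOpen hV (by simp)
  have hDKc : ContinuousAt (fderiv ℝ K) x₀ :=
    (hK1.continuousOn.continuousWithinAt hx₀).continuousAt hxs
  set Kb : ℝ := ‖K x₀‖ + 1 with hKb
  set DKb : ℝ := ‖fderiv ℝ K x₀‖ + 1 with hDKb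
  have hK' := eventually_norm_le_of_continuousAt hKc
  have hDK' := eventually_norm_le_of_continuousAt hDKc
  refine ⟨max C₁ 0 + max C₂ 0 * (1 + 4 * (DKb + Kb)), by positivity, ?_⟩
  filter_upwards [hC₁, hC₂, hK', hDK', hxs] with x h1 h2 hKx hDKx hx
  have hKb0 : 0 ≤ Kb := by positivity
  have hDKb0 : 0 ≤ DKb := by positivity
  have hxs' : V ∈ 𝓝 x := hV.mem_nhds hx
  have hKd : DifferentiableAt ℝ K x := (hK.differentiableOn (by simp)).differentiableAt hxs'
  have hNd : DifferentiableAt ℝ N x := (hN.differentiableOn two_ne_zero).differentiableAt hxs'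
  set J : ℝ := |N x| + ‖fderiv ℝ N x‖ + ‖X x‖ + ‖fderiv ℝ X x‖ with hJ
  have hJ0 : 0 ≤ J := by positivity
  -- the source derivative in terms of the jet
  have hDB : ‖fderiv ℝ (fun y ↦ -(4 * N y) • K y) x‖ ≤ 4 * (DKb + Kb) * J := by
    refine (norm_fderiv_source_le hKd hNd).trans ?_
    have a1 : |N x| * ‖fderiv ℝ K x‖ ≤ J * DKb := by
      gcongr
      rw [hJ]; linarith [norm_nonneg (fderiv ℝ N x), norm_nonneg (X x), norm_nonneg (fderiv ℝ X x)]
    have a2 : ‖fderiv ℝ N x‖ * ‖K x‖ ≤ J * Kb := by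
      gcongr
      rw [hJ]; linarith [abs_nonneg (N x), norm_nonneg (X x), norm_nonneg (fderiv ℝ X x)]
    nlinarith [a1, a2]
  have hM : ‖X x‖ + ‖fderiv ℝ X x‖ + ‖fderiv ℝ (fun y ↦ -(4 * N y) • K y) x‖ ≤
      (1 + 4 * (DKb + Kb)) * J := by
    have : ‖X x‖ + ‖fderiv ℝ X x‖ ≤ J := by
      rw [hJ]; linarith [abs_nonneg (N x), norm_nonneg (fderiv ℝ N x)]
    nlinarith [hDB, this]
  have hM0 : 0 ≤ ‖X x‖ + ‖fderiv ℝ X x‖ + ‖fderiv ℝ (fun y ↦ -(4 * N y) • K y) x‖ := by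
    positivity
  have h1' : ‖fderiv ℝ (fderiv ℝ N) x‖ ≤ max C₁ 0 * J :=
    h1.trans (mul_le_mul_of_nonneg_right (le_max_left _ _) hJ0)
  have h2' : ‖fderiv ℝ (fderiv ℝ X) x‖ ≤ max C₂ 0 * ((1 + 4 * (DKb + Kb)) * J) :=
    calc ‖fderiv ℝ (fderiv ℝ X) x‖
        ≤ max C₂ 0 * (‖X x‖ + ‖fderiv ℝ X x‖ + ‖fderiv ℝ (fun y ↦ -(4 * N y) • K y) x‖) :=
          h2.trans (mul_le_mul_of_nonneg_right (le_max_left _ _) hM0)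
      _ ≤ max C₂ 0 * ((1 + 4 * (DKb + Kb)) * J) := by gcongr
  calc ‖fderiv ℝ (fderiv ℝ N) x‖ + ‖fderiv ℝ (fderiv ℝ X) x‖
      ≤ max C₁ 0 * J + max C₂ 0 * ((1 + 4 * (DKb + Kb)) * J) := add_le_add h1' h2'
    _ = (max C₁ 0 + max C₂ 0 * (1 + 4 * (DKb + Kb))) * J := by ring

end Rigidity

end KIDJetRigidity

end Literature.Geometry.Lorentzian

end
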